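import Literature.Barriers.HodgeConjecture.IntegralCoefficientsCurveSemipurity
import Literature.AlgebraicTopology.SingularHomology.RelativeCochainsKroneckerCyclic
import Literature.AlgebraicTopology.SingularHomology.RelativeCapProduct
import HarnessLib

/-!
# Kollár (1992): purity for one irreducible curve ⇐ the Thom class of its straightened smooth part
# (the homological interface)

Sibling of `Literature/Barriers/HodgeConjecture/IntegralCoefficients{CurvePurity, CurveSemipurity}`.
`…CurvePurity` reduces the purity half of hypothesis (i') of the Kollár reduction — for an
irreducible closed curve `C` on the smooth projective threefold `X/ℂ`,
`ker (H⁴(X(ℂ);ℤ) → H⁴((X ∖ C)(ℂ);ℤ)) ≤ ℤ · τ_C` — to the cyclicity of the relative COHOMOLOGY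
`H⁴(U, U ∖ S; ℤ)` of the straightened smooth part `S = (C ∖ Z₁)(ℂ)` in `U = (X ∖ Z₁)(ℂ)`
(`ker_restrictComplInt_le_span_of_flat_cyclic`); `…CurveSemipurity` proves
`Hq(U, U ∖ S; ℤ) = 0` for `q < 4`. This file combines them with the cyclic case of Kronecker duality
for pairs (`relSingularCohomology_le_span_of_cyclic`, Hatcher §3.1 Thm. 3.2 for the relative complex,
`Ext(H₃, ℤ) = 0`) into the HOMOLOGICAL interface `ker_restrictComplInt_le_span_of_flat_homologyCyclic`:
purity for `C` follows once, for every finite bad set `Z₁ ⊆ C` off which `C(ℂ)` is straightened by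
charts `X(ℂ) ⇀ ℂ² × K` (`dim_ℝ K = 2`) and with `(C ∖ Z₁)(ℂ)` connected — data PROVIDED by the
tree (`GAGADimension.exists_closed_straightening_off`, `normalDim_eq_two_of_straightening`,
`ComplexPoints.isConnected_setOf_pt_mem_diff_of_isIrreducible`) — the relative singular HOMOLOGY
`H₄(U, U ∖ S; ℤ)` (`relativeSingularHomology`) is generated by one class: the Thom / fundamental
class of the connected, closed, locally flat, codimension-`4` subset `S` of the open `6`-manifold `U`
(Voisin I §11.1.2, proof of Lemma 11.13; Milnor–Stasheff §10), i.e. exactly the degree-`4` step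
above the tree's engine `surjective_injective_map_compl_of_locallyFlat` /
`RelativeMayerVietorisOpen` (generation by local classes, then all local classes on the connected
`S` are unit multiples of one another). Everything here is proved; no named facts.

## References

* [HatcherAT2002] A. Hatcher, Algebraic Topology, CUP 2002, §3.1 Thm. 3.2 (p. 195), pp. 199–200.
* [VoisinHodgeI2002] C. Voisin, Hodge Theory and Complex Algebraic Geometry I, §11.1.2 Lemma 11.13.
* [Fulton1998] W. Fulton, Intersection Theory, §19.1 Lemma 19.1.1.
* [SouleVoisin2005] C. Soulé, C. Voisin, Adv. Math. 198 (2005), §2 Thm. 2.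
* [KollarTrento1992] J. Kollár, Trento examples §1, Lemma p. 134, LNM 1515 (1992).
-/

noncomputable section

open CategoryTheory Limits AlgebraicGeometry Set Topology
open Literature.AlgebraicTopology.SingularHomology Literature.AlgebraicGeometry.Motives

namespace Literature.Barriers.HodgeConjecture

section Barriers
section HodgeConjecture

variable {X : SchemeOver ℂ}

/-- Cyclicity passes along an isomorphism of `ModuleCat` objects (images of spans). [folklore] -/
theorem forall_mem_span_singleton_of_iso {R : Type} [CommRing R] {A B : ModuleCat.{0} R} (e : A ≅ B)
    {θ : A} (hθ : ∀ y, y ∈ Submodule.span R ({θ} : Set A)) :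
    ∀ y, y ∈ Submodule.span R ({e.hom θ} : Set B) := by
  intro y
  have hy : e.hom.hom (e.inv y) ∈ (Submodule.span R ({θ} : Set A)).map e.hom.hom :=
    Submodule.mem_map_of_mem (hθ (e.inv y))
  rw [Submodule.map_span, Set.image_singleton] at hy
  have h : e.hom.hom (e.inv y) = y := CategoryTheory.Iso.inv_hom_id_apply e y
  rwa [h] at hy

/-- **Purity for one irreducible curve, from the Thom class of its straightened smooth part
(homological interface).** Let `X/ℂ` be a smooth projective threefold and `C ⊆ X` an irreducible
closed curve. Suppose that for every finite set `Z₁ ⊆ C` of closed points off which `C(ℂ)` is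
straightened by charts `X(ℂ) ⇀ ℂ² × K`, `dim_ℝ K = 2`, and with `(C ∖ Z₁)(ℂ)` connected, the
relative singular HOMOLOGY `H₄(U, U ∖ S; ℤ)`, `U = (X ∖ Z₁)(ℂ)`, `U ∖ S = (X ∖ C)(ℂ)`, is generated
by one class (the fundamental class of the connected codimension-`4` locally flat closed subset `S`
of `U` [cite: VoisinHodgeI2002, §11.1.2 proof of Lemma 11.13]). Then
`ker (H⁴(X(ℂ);ℤ) → H⁴((X ∖ C)(ℂ);ℤ)) ≤ ℤ · τ_C` for one class `τ_C` — in print `τ_C = cl(C)`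
[cite: Fulton1998, §19.1 Lemma 19.1.1]; with `τ_C = (deg C) α` and Kollár's `p ∣ deg C`
[cite: SouleVoisin2005, §2 Thm. 2] [cite: KollarTrento1992, §1 Lemma p. 134] this is hypothesis (i')
of `Kollar1992_nonTorsionClass_notAlgebraic_of_ker_le_span_of_curves`. Proof: `H₃(U, U ∖ S; ℤ) = 0`
(`isZero_relativeSingularHomology_of_straightened`), so `H⁴(U, U ∖ S; ℤ)` is cyclic by Kronecker
duality for the pair (`relSingularCohomology_le_span_of_cyclic`), and
`ker_restrictComplInt_le_span_of_flat_cyclic` applies. [cite: HatcherAT2002, §3.1 Thm. 3.2 (p. 195) and pp. 199–200] -/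
theorem ker_restrictComplInt_le_span_of_flat_homologyCyclic (hX : IsSmoothProjective 3 X)
    {C : Set X.left} (hC : IsClosed C) (hCi : IsIrreducible C)
    (hC2 : ∀ z ∈ C, ((2 : ℕ) : ℕ∞) ≤ Order.coheight z) (hCx : ∃ z ∈ C, Order.coheight z = (2 : ℕ))
    (htop : ∀ Z₁ : Set X.left, IsClosed Z₁ → Z₁ ⊆ C → Z₁.Finite →
      (∀ z ∈ Z₁, IsClosed ({z} : Set X.left)) →
      (∀ P : ComplexPoints X, P.pt ∈ C → P.pt ∉ Z₁ →
        ∃ (K : Submodule ℂ (Fin 3 → ℂ))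
          (e : OpenPartialHomeomorph (ComplexPoints X) ((Fin 2 → ℂ) × K)),
          Module.finrank ℝ ↥K = 2 ∧ P ∈ e.source ∧ ∀ Q ∈ e.source, Q.pt ∈ C ↔ (e Q).1 = 0) →
      IsConnected {P : ComplexPoints X | P.pt ∈ C ∧ P.pt ∉ Z₁} →
      ∃ θ : relativeSingularHomology ℤ ℤ (complexPointsCompl X Z₁)
          {Q : complexPointsCompl X Z₁ | Q.1.pt ∉ C} 4,
        ∀ y, y ∈ Submodule.span ℤ ({θ} : Set (relativeSingularHomology ℤ ℤ (complexPointsCompl X Z₁)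
          {Q : complexPointsCompl X Z₁ | Q.1.pt ∉ C} 4))) :
    ∃ τ : bettiCohomologyInt X (2 * 2),
      LinearMap.ker (restrictComplInt X C (2 * 2)).hom ≤ Submodule.span ℤ {τ} := by
  refine ker_restrictComplInt_le_span_of_flat_cyclic hX hC hCi hC2 hCx
    fun Z₁ hZ₁c hZ₁C hZ₁f hZ₁cl hstr hconn ↦ ?_
  obtain ⟨θ, hθ⟩ := htop Z₁ hZ₁c hZ₁C hZ₁f hZ₁cl hstr hconn
  -- the pair `(U, U ∖ S)` in the concrete model
  let U := complexPointsCompl X Z₁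
  let A : Set U := {Q | Q.1.pt ∉ C}
  -- `H₃(U, U ∖ S; ℤ) = 0`, hence projective (concrete model)
  have hstr' : ∀ P : ComplexPoints X, P.pt ∈ C → P.pt ∉ Z₁ →
      ∃ (K : Submodule ℂ (Fin 3 → ℂ)) (e : OpenPartialHomeomorph (ComplexPoints X) ((Fin 2 → ℂ) × K)),
        P ∈ e.source ∧ ∀ Q ∈ e.source, Q.pt ∈ C ↔ (e Q).1 = 0 := fun P hPC hPZ ↦ by
    obtain ⟨K, e, -, hP, he⟩ := hstr P hPC hPZ
    exact ⟨K, e, hP, he⟩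
  have h3 : IsZero ((chainsInSub ℤ ℤ U A).quotient.homology 3) :=
    (isZero_relativeSingularHomology_of_straightened ℤ ℤ hX hC hZ₁c hstr' (by norm_num)).of_iso
      (relativeSingularHomology.concreteIso ℤ ℤ U A 3).symm
  haveI := ModuleCat.subsingleton_of_isZero h3
  have hproj : Module.Projective ℤ ((chainsInSub ℤ ℤ U A).quotient.homology 3) :=
    Module.Projective.of_free
  -- transport `θ` to the concrete model and apply Kronecker duality for the pair
  obtain ⟨Θ, hΘ⟩ := relSingularCohomology_le_span_of_cyclic (X := U) (A := A) hproj
    ((relativeSingularHomology.concreteIso ℤ ℤ U A 4).hom θ)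
    (forall_mem_span_singleton_of_iso (relativeSingularHomology.concreteIso ℤ ℤ U A 4) hθ)
  exact ⟨Θ, hΘ⟩

end HodgeConjecture
end Barriers

end Literature.Barriers.HodgeConjecture

end
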